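import Mathlib
import HarnessLib
import Summits.AtomisticToContinuum.FouriersLaw.Theses.JunctionLocality
import Summits.AtomisticToContinuum.FouriersLaw.Theses.StaticAbelianSqueeze
import Summits.AtomisticToContinuum.FouriersLaw.Theses.CageBudgetFekete
import Summits.AtomisticToContinuum.FouriersLaw.Theorems.StaticAbelianSqueezeKuboAbelIdentity
import Summits.AtomisticToContinuum.FouriersLaw.Theorems.LatticeLandauDampingAbelThermodynamicLimitOfUniformAbelianRegularity

/-!
# Crux `ConductanceLowerBound` (item stmt-AtomisticToContinuum-11749), line `abel-floor-exchange`: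
# stub `stub_bulkAbelFloor_of_heatVarianceBets` PROVED, and the crux on route CageBudgetFekete from the route's OTHER items

Support file (`--supports stmt-AtomisticToContinuum-11749`; closes nothing) for the skeleton
`Cruxes/ConductanceLowerBound/Lines/abel_floor_exchange.lean` (crux-strategist s2, 2026-08-17).

The language of the line is the open-chain Green–Kubo/Abel one: by the landed Kubo identity (K)
(`StaticAbelianSqueeze.kuboAbelIdentity_holds`) `(N−1)T²D_N = ∫₀^∞ c_N`, and at an `N`-independent Abel frequency `ν`
`∫₀^∞ c_N = F_N(ν) + I_N(ν)` (`integral_abelSplit`).  Contents: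

* `stub_bulkAbelFloor_of_heatVarianceBets` — the REGISTERED stub 3 of the line, verbatim, PROVED: from route CageBudgetFekete's
  `SymmetricSetup`, `HeatVarianceCalculus`, `QuasiSuperadditiveHeatVariance` (defect `K`) and `UnboundedHeatVariance` — and NOT
  the ceiling — there is a shift-invariant Gibbs state `μ_T`, a `μ_T`-preserving dynamics `D` and `a, ν₀ > 0` with
  `a ≤ ∫₀^∞ e^{−νt} C_T(t) dt` for all `ν ∈ (0, ν₀)` (BULK ABEL FLOOR): pick `τ₀ > 0` with `V(τ₀) > K+1` (unboundedness); iterated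
  quasi-superadditivity gives the affine floor `V(t) ≥ t/τ₀ − (K+1)`; the Laplace identity `∫e^{−νt}C_T = (ν²/2)∫e^{−νt}V_T` and the
  explicit integrals `∫₀^∞e^{−νt} = 1/ν`, `∫₀^∞te^{−νt} = 1/ν²` give `∫e^{−νt}C_T ≥ 1/(2τ₀) − (K+1)ν/2 ≥ 1/(4τ₀)`.
* `slowRegularity_signed_of_uniformAbelianRegularity` — item (R) `StaticAbelianSqueeze.UniformAbelianRegularity` (stmt-13416)
  implies the line's stub 2 (R⁻) `−εN ≤ I_N(ν)` (its lower half).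
* `abelFloor_openChain_of_bulkWitness` — a bulk Abel floor witness implies the line's stub 1 (A⁻) `F_N(ν) ≥ (a/2)N` eventually in
  `N` (regularisation of the pair: shift-invariant ⇒ one-site tight ⇒ superstable, restriction of the dynamics to `bmGood` orbits with
  the same flow; then the landed fixed-frequency matching S3 `fixedFrequencyMatching_of_registeredLeaves`: `F_N(ν)/N → Â(ν) ≥ a`).
* `conductanceLowerBound_of_abelFloor_and_signedSlowRegularity` — (A⁻) → (R⁻) → `ConductanceLowerBound` ((K) + Abelian split +
  arithmetic: `(N−1)T²D_N ≥ aN − (a/2)N`, so `D_N ≥ a/(2T²)` for `N ≥ max(N₀,N₀′,2)`).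
* `conductanceLowerBound_of_heatVarianceBets` — COROLLARY (the route reading): on route CageBudgetFekete the child
  `ConductanceLowerBound` of the split of `AbelThermodynamicLimit` follows from the route's items `SymmetricSetup`,
  `HeatVarianceCalculus`, `QuasiSuperadditiveHeatVariance`, `UnboundedHeatVariance` and the sibling child `UniformAbelianRegularity`
  (stmt-13416) — so on that route stmt-11749 carries no content beyond the route's other items.

References: Kundu–Dhar–Narayan 2009 (open-system Green–Kubo); Bonetto–Lebowitz–Rey-Bellet 2000 §7; Helfand 1960 (Einstein–Helfand
heat variance); Fekete's lemma with bounded defect.  No definitions, no named facts, no sorry.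
-/

noncomputable section

open MeasureTheory Filter Set Topology
open Literature.MathematicalPhysics.KineticTheory.HeatConduction
open Summit.AtomisticToContinuum.FouriersLaw.Theorems
open Summit.AtomisticToContinuum.FouriersLaw.Theorems.AbelThermodynamicLimit.SeriesLawAtEveryLaplaceFrequency

namespace Summit.AtomisticToContinuum.FouriersLaw.Cruxes.ConductanceLowerBound.AbelFloorExchange

/-! ## §1 The registered stub, proved -/

/-- **Stub 3 of line `abel-floor-exchange`, PROVED: BULK ABEL FLOOR FROM THE HEAT-VARIANCE BETS of route CageBudgetFekete.**
From `SymmetricSetup`, `HeatVarianceCalculus`, `QuasiSuperadditiveHeatVariance` (defect `K`) and `UnboundedHeatVariance` — and NOT the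
ceiling — : pick `τ₀ > 0` with `V(τ₀) > K + 1`; iterated quasi-superadditivity gives the affine floor `V(t) ≥ t/τ₀ − (K+1)` (`t > 0`),
and the Laplace identity `∫e^{−νt}C_T = (ν²/2)∫e^{−νt}V_T` with `∫₀^∞e^{−νt} = 1/ν`, `∫₀^∞te^{−νt} = 1/ν²` gives
`∫₀^∞ e^{−νt} C_T ≥ 1/(2τ₀) − (K+1)ν/2 ≥ 1/(4τ₀)` for `ν < 1/(2τ₀(K+1))`. [folklore] -/
theorem stub_bulkAbelFloor_of_heatVarianceBets :
    Summit.AtomisticToContinuum.FouriersLaw.Theses.CageBudgetFekete.SymmetricSetup →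
    Summit.AtomisticToContinuum.FouriersLaw.Theses.CageBudgetFekete.HeatVarianceCalculus →
    Summit.AtomisticToContinuum.FouriersLaw.Theses.CageBudgetFekete.QuasiSuperadditiveHeatVariance →
    Summit.AtomisticToContinuum.FouriersLaw.Theses.CageBudgetFekete.UnboundedHeatVariance →
    ∀ ω₂ lam β γ : ℝ, 0 < ω₂ → 0 < lam → 0 < β → 0 < γ → ∀ T : ℝ, 0 < T →
      ∃ (μT : Measure ChainConfig) (D : InfiniteChainDynamics (pinnedChain ω₂ lam β γ)) (a ν₀ : ℝ),
        (pinnedChain ω₂ lam β γ).IsChainGibbsMeasure T μT ∧ IsShiftInvariant μT ∧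
        D.PreservesMeasure μT ∧ (∀ t : ℝ, D.HasAbsConvergentCorrelation μT t) ∧ 0 < a ∧ 0 < ν₀ ∧
        ∀ ν : ℝ, 0 < ν → ν < ν₀ →
          a ≤ ∫ t in Set.Ioi (0:ℝ), Real.exp (-(ν * t)) * D.currentCorrelation μT t := by
  intro hSet hHC hQ hU ω₂ lam β γ hω hl hβ _hγ T hT
  obtain ⟨μT, hG, hSI, hRefl, D, hP, hShift⟩ := hSet ω₂ lam β γ hω hl hβ T hT
  obtain ⟨hAC, hCc, hrest⟩ := hHC ω₂ lam β γ hω hl hβ T hT μT hG hSI hRefl D hP hShift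
  set V : ℝ → ℝ := fun τ => 2 * ∫ s in Ioc (0:ℝ) τ, (τ - s) * D.currentCorrelation μT s with hV
  obtain ⟨hV0, hLap⟩ := hrest V hV
  obtain ⟨K, hK, hQ'⟩ := hQ ω₂ lam β γ hω hl hβ T hT μT hG hSI hRefl D hP hShift hAC hCc V hV
  have hU' := hU ω₂ lam β γ hω hl hβ T hT μT hG hSI hRefl D hP hShift hAC hCc V hV
  set A : ℝ → ℝ := fun ν => ∫ t in Ioi (0:ℝ), Real.exp (-(ν * t)) * D.currentCorrelation μT t with hAd
  have hA : ∀ ν : ℝ, 0 < ν → A ν = ν ^ 2 / 2 * ∫ t in Ioi (0:ℝ), Real.exp (-(ν * t)) * V t :=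
    fun ν hν => (hLap ν hν).2.2
  have hint : ∀ ν : ℝ, 0 < ν → IntegrableOn (fun t => Real.exp (-(ν * t)) * V t) (Ioi 0) :=
    fun ν hν => (hLap ν hν).2.1
  -- iterated quasi-superadditivity
  have iter : ∀ (n : ℕ) (t : ℝ), 0 ≤ t → (n : ℝ) * (V t - K) ≤ V ((n : ℝ) * t) := by
    intro n t ht
    induction n with
    | zero => simpa using hV0 0 le_rfl
    | succ n ih =>
      have h1 := hQ' ((n : ℝ) * t) t (by positivity) ht
      push_cast
      rw [show ((n : ℝ) + 1) * t = (n : ℝ) * t + t by ring]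
      nlinarith
  -- an uncaged time `τ₀ > 0`: `V τ₀ > K + 1`
  obtain ⟨τ₀, hτ0, hτ⟩ := hU' (K + 1)
  have hτpos : 0 < τ₀ := by
    rcases hτ0.lt_or_eq with h | h
    · exact h
    · exfalso
      rw [← h] at hτ
      have : V 0 = 0 := by simp [hV]
      linarith
  -- affine floor `V t ≥ t/τ₀ − (K+1)` for `t > 0`
  have hlow : ∀ t : ℝ, 0 < t → τ₀⁻¹ * t + (-(K + 1)) ≤ V t := by
    intro t ht
    set n := ⌊t / τ₀⌋₊ with hn
    have hnle : (n : ℝ) * τ₀ ≤ t := by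
      have := Nat.floor_le (show 0 ≤ t / τ₀ by positivity)
      rw [← hn] at this
      rwa [le_div_iff₀ hτpos] at this
    have hlt' : t < (n : ℝ) * τ₀ + τ₀ := by
      have := Nat.lt_floor_add_one (t / τ₀)
      rw [← hn, div_lt_iff₀ hτpos] at this
      linarith
    have hr : 0 ≤ t - (n : ℝ) * τ₀ := by linarith
    have h1 := hQ' ((n : ℝ) * τ₀) (t - (n : ℝ) * τ₀) (by positivity) hr
    rw [show (n : ℝ) * τ₀ + (t - (n : ℝ) * τ₀) = t by ring] at h1
    have h2 := iter n τ₀ hτpos.le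
    have h3 := hV0 _ hr
    have h4 : (n : ℝ) * 1 ≤ (n : ℝ) * (V τ₀ - K) :=
      mul_le_mul_of_nonneg_left (by linarith) (Nat.cast_nonneg n)
    have h5 : τ₀⁻¹ * t < (n : ℝ) + 1 := by
      rw [inv_mul_eq_div, div_lt_iff₀ hτpos]
      linarith
    nlinarith
  -- explicit Laplace integrals
  have hE0 : ∀ ν : ℝ, 0 < ν → IntegrableOn (fun t => Real.exp (-(ν * t))) (Ioi 0) ∧
      ∫ t in Ioi (0:ℝ), Real.exp (-(ν * t)) = ν⁻¹ := fun ν hν => by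
    refine ⟨by simpa only [neg_mul] using exp_neg_integrableOn_Ioi 0 hν, ?_⟩
    rw [show (fun t : ℝ => Real.exp (-(ν * t))) = fun t => Real.exp (-ν * t) from funext fun t => by rw [neg_mul],
      integral_exp_mul_Ioi (neg_lt_zero.mpr hν) 0, mul_zero, Real.exp_zero, neg_div, one_div, inv_neg, neg_neg]
  have hE1 : ∀ ν : ℝ, 0 < ν → IntegrableOn (fun t => Real.exp (-(ν * t)) * t) (Ioi 0) ∧
      ∫ t in Ioi (0:ℝ), Real.exp (-(ν * t)) * t = (ν ^ 2)⁻¹ := fun ν hν => by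
    have h := Real.integral_rpow_mul_exp_neg_mul_Ioi (a := 2) (r := ν) (by norm_num) hν
    rw [Real.Gamma_two, mul_one, Real.rpow_two, one_div, inv_pow] at h
    have hv : ∫ t in Ioi (0:ℝ), Real.exp (-(ν * t)) * t = (ν ^ 2)⁻¹ :=
      (setIntegral_congr_fun measurableSet_Ioi fun t _ => by
        rw [show (2:ℝ) - 1 = 1 by norm_num, Real.rpow_one, mul_comm]).trans h
    exact ⟨Integrable.of_integral_ne_zero (by rw [hv]; positivity), hv⟩
  have key : ∀ ν : ℝ, 0 < ν → ∀ p q : ℝ, IntegrableOn (fun t => Real.exp (-(ν * t)) * (p * t + q)) (Ioi 0) ∧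
      ∫ t in Ioi (0:ℝ), Real.exp (-(ν * t)) * (p * t + q) = p * (ν ^ 2)⁻¹ + q * ν⁻¹ := fun ν hν p q => by
    obtain ⟨hi0, hv0⟩ := hE0 ν hν
    obtain ⟨hi1, hv1⟩ := hE1 ν hν
    rw [show (fun t : ℝ => Real.exp (-(ν * t)) * (p * t + q)) =
        fun t => p * (Real.exp (-(ν * t)) * t) + q * Real.exp (-(ν * t)) from funext fun t => by ring]
    exact ⟨(hi1.const_mul p).add (hi0.const_mul q), by
      rw [integral_add (hi1.const_mul p) (hi0.const_mul q), integral_const_mul, integral_const_mul, hv1, hv0]⟩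
  -- the Abelian lower bound `A ν ≥ 1/(2τ₀) − (K+1)/2 · ν`
  have hAlow : ∀ ν : ℝ, 0 < ν → τ₀⁻¹ / 2 - (K + 1) / 2 * ν ≤ A ν := by
    intro ν hν
    obtain ⟨iL, vL⟩ := key ν hν τ₀⁻¹ (-(K + 1))
    have cL := setIntegral_mono_on iL (hint ν hν) measurableSet_Ioi
      fun t ht => mul_le_mul_of_nonneg_left (hlow t ht) (Real.exp_pos (-(ν * t))).le
    rw [vL] at cL
    rw [hA ν hν, ← show ν ^ 2 / 2 * (τ₀⁻¹ * (ν ^ 2)⁻¹ + -(K + 1) * ν⁻¹) = τ₀⁻¹ / 2 - (K + 1) / 2 * ν by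
      field_simp; ring]
    exact mul_le_mul_of_nonneg_left cL (by positivity)
  -- output the witness
  refine ⟨μT, D, τ₀⁻¹ / 4, (2 * τ₀ * (K + 1))⁻¹, hG, hSI, hP, hAC, by positivity, by positivity, fun ν hν hνlt => ?_⟩
  have h1 := hAlow ν hν
  have h2 : (K + 1) / 2 * ν ≤ τ₀⁻¹ / 4 := by
    have hprod : ν * (2 * τ₀ * (K + 1)) < 1 := by
      have := mul_lt_mul_of_pos_right hνlt (show 0 < 2 * τ₀ * (K + 1) by positivity)
      rwa [inv_mul_cancel₀ (by positivity)] at this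
    refine le_of_mul_le_mul_left ?_ hτpos
    have e0 : τ₀ * (τ₀⁻¹ / 4) = 1 / 4 := by field_simp
    have e1 : τ₀ * ((K + 1) / 2 * ν) = (ν * (2 * τ₀ * (K + 1))) / 4 := by ring
    rw [e0, e1]
    linarith
  show τ₀⁻¹ / 4 ≤ A ν
  linarith


/-! ## §2 Bridges from the existing items / the bulk witness to the line's stubs 1–2 -/

/-- **(R) ⇒ (R⁻)**: the existing item `StaticAbelianSqueeze.UniformAbelianRegularity` (stmt-AtomisticToContinuum-13416, verbatim the
CageBudgetFekete / EmbeddedDrudeMourre child) implies stub 2 (drop the upper half of `|I_N(ν)| ≤ εN`). [folklore] -/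
theorem slowRegularity_signed_of_uniformAbelianRegularity
    (hR : Summit.AtomisticToContinuum.FouriersLaw.Theses.StaticAbelianSqueeze.UniformAbelianRegularity) :
    ∀ ω₂ lam β γ : ℝ, 0 < ω₂ → 0 < lam → 0 < β → 0 < γ → ∀ T : ℝ, 0 < T →
      ∀ ε : ℝ, 0 < ε → ∃ ν₀ : ℝ, 0 < ν₀ ∧ ∀ ν : ℝ, 0 < ν → ν < ν₀ → ∃ N₀ : ℕ, ∀ N : ℕ, N₀ ≤ N →
        -(ε * N) ≤ ∫ t in Set.Ioi (0:ℝ), (1 - Real.exp (-(ν * t))) *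
          ∫ z, (∑ i : Fin N, (pinnedChain ω₂ lam β γ).bondCurrent N i z) *
            (∫ y, (∑ i : Fin N, (pinnedChain ω₂ lam β γ).bondCurrent N i y)
              ∂((pinnedChain ω₂ lam β γ).transitionKernel N T T t.toNNReal z))
            ∂((pinnedChain ω₂ lam β γ).gibbsMeasure N T) := by
  intro ω₂ lam β γ hω hl hβ hγ T hT ε hε
  obtain ⟨ν₀, hν₀, h⟩ := hR ω₂ lam β γ hω hl hβ hγ T hT ε hε
  refine ⟨ν₀, hν₀, fun ν hν hlt => ?_⟩
  obtain ⟨N₀, hN₀⟩ := h ν hν hlt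
  refine ⟨N₀, fun N hN => ?_⟩
  have h1 := hN₀ N hN
  exact (abs_le.mp h1).1

/-- **Bulk Abel floor witness ⇒ (A⁻)** (infinite volume ⇒ open chains, at FIXED frequency): a shift-invariant DLR state is one-site
tight, hence (the) shift-invariant superstable state; restricting the dynamics to its `bmGood` orbits (same flow, same correlations)
makes the pair regular; the landed fixed-frequency matching S3 gives `F_N(ν)/N → Â(ν) ≥ a`, so eventually `F_N(ν) ≥ (a/2)·N`.
[folklore] -/
theorem abelFloor_openChain_of_bulkWitness
    (hW : ∀ ω₂ lam β γ : ℝ, 0 < ω₂ → 0 < lam → 0 < β → 0 < γ → ∀ T : ℝ, 0 < T →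
      ∃ (μT : Measure ChainConfig) (D : InfiniteChainDynamics (pinnedChain ω₂ lam β γ)) (a ν₀ : ℝ),
        (pinnedChain ω₂ lam β γ).IsChainGibbsMeasure T μT ∧ IsShiftInvariant μT ∧
        D.PreservesMeasure μT ∧ (∀ t : ℝ, D.HasAbsConvergentCorrelation μT t) ∧ 0 < a ∧ 0 < ν₀ ∧
        ∀ ν : ℝ, 0 < ν → ν < ν₀ →
          a ≤ ∫ t in Set.Ioi (0:ℝ), Real.exp (-(ν * t)) * D.currentCorrelation μT t) :
    ∀ ω₂ lam β γ : ℝ, 0 < ω₂ → 0 < lam → 0 < β → 0 < γ → ∀ T : ℝ, 0 < T →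
      ∃ a : ℝ, 0 < a ∧ ∃ ν₀ : ℝ, 0 < ν₀ ∧ ∀ ν : ℝ, 0 < ν → ν < ν₀ → ∃ N₀ : ℕ, ∀ N : ℕ, N₀ ≤ N →
        a * N ≤ ∫ t in Set.Ioi (0:ℝ), Real.exp (-(ν * t)) *
          ∫ z, (∑ i : Fin N, (pinnedChain ω₂ lam β γ).bondCurrent N i z) *
            (∫ y, (∑ i : Fin N, (pinnedChain ω₂ lam β γ).bondCurrent N i y)
              ∂((pinnedChain ω₂ lam β γ).transitionKernel N T T t.toNNReal z))
            ∂((pinnedChain ω₂ lam β γ).gibbsMeasure N T) := by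
  intro ω₂ lam β γ hω hl hβ hγ T hT
  obtain ⟨μT, D', a, ν₀, hG, hS, hP', hAC', ha, hν₀, hfloor⟩ := hW ω₂ lam β γ hω hl hβ hγ T hT
  haveI : IsProbabilityMeasure μT := hG.1
  have htight := Literature.MathematicalPhysics.KineticTheory.HeatConduction.oneSiteTight_of_isShiftInvariant
    (μ := μT) hS
  obtain ⟨_, hss⟩ :=
    OscillatorChain.isShiftInvariant_and_hasSuperstabilityEstimate_of_tight_pinnedChain γ hω hl.le hβ.le hT hG htight
  -- regularise the dynamics: restrict to the orbits staying in `bmGood` (same flow)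
  have horb : ∀ᵐ σ ∂μT, ∀ t : ℝ, D'.flow t σ ∈ (pinnedChain ω₂ lam β γ).bmGood :=
    OscillatorChain.ae_forall_flow_mem_bmGood_pinnedChain γ hω.le hl hβ hss D' hP'
  obtain ⟨D, hcar, hflow⟩ :=
    GreenKuboContinuation.TemperatureBlindVitaliHurwitz.exists_restrictOrbits D' (pinnedChain ω₂ lam β γ).bmGood
  have hcarsub : D.carrier ⊆ (pinnedChain ω₂ lam β γ).bmGood := by
    intro σ hσ
    rw [hcar] at hσ
    have h0 := hσ.2 0
    rwa [D'.flow_zero σ hσ.1] at h0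
  have hP : D.PreservesMeasure μT := by
    refine GreenKuboContinuation.TemperatureBlindVitaliHurwitz.preservesMeasure_of_flow_eq hflow ?_ hP'
    rw [hcar]
    filter_upwards [hP'.1, horb] with σ h1 h2 using ⟨h1, h2⟩
  have hAC : ∀ t : ℝ, D.HasAbsConvergentCorrelation μT t := fun t => by
    rw [GreenKuboContinuation.TemperatureBlindVitaliHurwitz.hasAbsConvergentCorrelation_iff_of_flow_eq hflow]
    exact hAC' t
  have hcorr : D.currentCorrelation μT = D'.currentCorrelation μT :=
    GreenKuboContinuation.TemperatureBlindVitaliHurwitz.currentCorrelation_eq_of_flow_eq hflow μT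
  -- S3 at the regular pair
  have hS3 := fixedFrequencyMatching_of_registeredLeaves stub_uniformAnchoredCorrelationTails
    stub_uniformFixedTimeOffsetMatching ω₂ lam β γ hω hl hβ hγ T hT
    (stub_regularDLRUnique ω₂ lam β γ hω hl hβ hγ T hT) μT D hG hS hss hcarsub hP hAC
  refine ⟨a / 2, by positivity, ν₀, hν₀, fun ν hν hlt => ?_⟩
  have hA : a ≤ ∫ t in Ioi (0:ℝ), Real.exp (-(ν * t)) * D.currentCorrelation μT t := by
    rw [hcorr]
    exact hfloor ν hν hlt
  have hlt2 : a / 2 < ∫ t in Ioi (0:ℝ), Real.exp (-(ν * t)) * D.currentCorrelation μT t := by linarith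
  have hev := (hS3 ν hν).eventually (Ioi_mem_nhds hlt2)
  obtain ⟨N₀, hN₀⟩ := Filter.eventually_atTop.mp (hev.and (eventually_ge_atTop 1))
  refine ⟨N₀, fun N hN => ?_⟩
  obtain ⟨h1, h2⟩ := hN₀ N hN
  have hNpos : (0:ℝ) < N := by exact_mod_cast h2
  have h3 := (lt_div_iff₀ hNpos).mp h1
  exact h3.le

/-! ## §3 The composition in binder form -/

/-- **COMPOSITION, binder form.** (A⁻) → (R⁻) → `ConductanceLowerBound` (stated at the `StaticAbelianSqueeze` copy of the shared decl,
definitionally equal to the JunctionLocality / CageBudgetFekete / LogConcaveRigidity copies): with the landed Kubo identity (K)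
`(N−1)T²D_N = ∫₀^∞ c_N` and the Abelian split at `ν = min(ν₀,ν₀′)/2`, `(N−1)T²D_N ≥ aN − (a/2)N = (a/2)N ≥ (a/2)(N−1)`, so
`D_N ≥ a/(2T²)` for `N ≥ max(N₀, N₀′, 2)`. [folklore] -/
theorem conductanceLowerBound_of_abelFloor_and_signedSlowRegularity :
    (∀ ω₂ lam β γ : ℝ, 0 < ω₂ → 0 < lam → 0 < β → 0 < γ → ∀ T : ℝ, 0 < T →
      ∃ a : ℝ, 0 < a ∧ ∃ ν₀ : ℝ, 0 < ν₀ ∧ ∀ ν : ℝ, 0 < ν → ν < ν₀ → ∃ N₀ : ℕ, ∀ N : ℕ, N₀ ≤ N →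
        a * N ≤ ∫ t in Set.Ioi (0:ℝ), Real.exp (-(ν * t)) *
          ∫ z, (∑ i : Fin N, (pinnedChain ω₂ lam β γ).bondCurrent N i z) *
            (∫ y, (∑ i : Fin N, (pinnedChain ω₂ lam β γ).bondCurrent N i y)
              ∂((pinnedChain ω₂ lam β γ).transitionKernel N T T t.toNNReal z))
            ∂((pinnedChain ω₂ lam β γ).gibbsMeasure N T)) →
    (∀ ω₂ lam β γ : ℝ, 0 < ω₂ → 0 < lam → 0 < β → 0 < γ → ∀ T : ℝ, 0 < T →
      ∀ ε : ℝ, 0 < ε → ∃ ν₀ : ℝ, 0 < ν₀ ∧ ∀ ν : ℝ, 0 < ν → ν < ν₀ → ∃ N₀ : ℕ, ∀ N : ℕ, N₀ ≤ N →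
        -(ε * N) ≤ ∫ t in Set.Ioi (0:ℝ), (1 - Real.exp (-(ν * t))) *
          ∫ z, (∑ i : Fin N, (pinnedChain ω₂ lam β γ).bondCurrent N i z) *
            (∫ y, (∑ i : Fin N, (pinnedChain ω₂ lam β γ).bondCurrent N i y)
              ∂((pinnedChain ω₂ lam β γ).transitionKernel N T T t.toNNReal z))
            ∂((pinnedChain ω₂ lam β γ).gibbsMeasure N T)) →
    Summit.AtomisticToContinuum.FouriersLaw.Theses.StaticAbelianSqueeze.ConductanceLowerBound := by
  intro hA hR ω₂ lam β γ hω hl hβ hγ hU μ hμ T hT Dn hDn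
  obtain ⟨a, ha, ν₁, hν₁, hAν⟩ := hA ω₂ lam β γ hω hl hβ hγ T hT
  obtain ⟨ν₂, hν₂, hRν⟩ := hR ω₂ lam β γ hω hl hβ hγ T hT (a / 2) (by positivity)
  set ν : ℝ := min ν₁ ν₂ / 2 with hνdef
  have hν : 0 < ν := by
    have : 0 < min ν₁ ν₂ := lt_min hν₁ hν₂
    rw [hνdef]; linarith
  have hνlt₁ : ν < ν₁ := by
    have : min ν₁ ν₂ ≤ ν₁ := min_le_left _ _
    rw [hνdef]; linarith
  have hνlt₂ : ν < ν₂ := by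
    have : min ν₁ ν₂ ≤ ν₂ := min_le_right _ _
    rw [hνdef]; linarith
  obtain ⟨N₁, hN₁⟩ := hAν ν hν hνlt₁
  obtain ⟨N₂, hN₂⟩ := hRν ν hν hνlt₂
  refine ⟨a / (2 * T ^ 2), by positivity, max (max N₁ N₂) 2, fun N hN => ?_⟩
  have hN1 : N₁ ≤ N := le_trans (le_trans (le_max_left _ _) (le_max_left _ _)) hN
  have hN2 : N₂ ≤ N := le_trans (le_trans (le_max_right _ _) (le_max_left _ _)) hN
  have hN3 : 2 ≤ N := le_trans (le_max_right _ _) hN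
  -- the finite-chain autocorrelation as a named function
  obtain ⟨c, hc⟩ : ∃ c : ℕ → ℝ → ℝ, c = fun (N : ℕ) (t : ℝ) =>
      ∫ z, (∑ i : Fin N, (pinnedChain ω₂ lam β γ).bondCurrent N i z) *
        (∫ y, (∑ i : Fin N, (pinnedChain ω₂ lam β γ).bondCurrent N i y)
          ∂((pinnedChain ω₂ lam β γ).transitionKernel N T T t.toNNReal z))
        ∂((pinnedChain ω₂ lam β γ).gibbsMeasure N T) := ⟨_, rfl⟩
  have hK : IntegrableOn (c N) (Ioi 0) ∧ ((N : ℝ) - 1) * T ^ 2 * Dn N = ∫ t in Ioi (0 : ℝ), c N t := by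
    simpa only [hc] using
      StaticAbelianSqueeze.kuboAbelIdentity_holds ω₂ lam β γ hω hl hβ hγ hU μ hμ T hT N (Dn N) (hDn N)
  have hF : a * N ≤ ∫ t in Ioi (0:ℝ), Real.exp (-(ν * t)) * c N t := by
    simpa only [hc] using hN₁ N hN1
  have hI : -(a / 2 * N) ≤ ∫ t in Ioi (0:ℝ), (1 - Real.exp (-(ν * t))) * c N t := by
    simpa only [hc] using hN₂ N hN2
  have hsplit := integral_abelSplit (c N) ν hν hK.1
  have key : a / 2 * N ≤ ((N : ℝ) - 1) * T ^ 2 * Dn N := by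
    rw [hK.2, hsplit]; linarith
  have hT2 : (0:ℝ) < T ^ 2 := by positivity
  have hNge : (2:ℝ) ≤ N := by exact_mod_cast hN3
  have hpos : (0:ℝ) < (N : ℝ) - 1 := by linarith
  by_contra hlt
  rw [not_le] at hlt
  have h5 : T ^ 2 * Dn N < a / 2 := by
    have := mul_lt_mul_of_pos_left hlt hT2
    rwa [show T ^ 2 * (a / (2 * T ^ 2)) = a / 2 by field_simp] at this
  have h6 : ((N : ℝ) - 1) * (T ^ 2 * Dn N) < ((N : ℝ) - 1) * (a / 2) :=
    mul_lt_mul_of_pos_left h5 hpos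
  have h7 : ((N : ℝ) - 1) * (a / 2) ≤ a / 2 * N := by nlinarith
  have : ((N : ℝ) - 1) * T ^ 2 * Dn N < a / 2 * N := by
    calc ((N : ℝ) - 1) * T ^ 2 * Dn N = ((N : ℝ) - 1) * (T ^ 2 * Dn N) := by ring
      _ < ((N : ℝ) - 1) * (a / 2) := h6
      _ ≤ a / 2 * N := h7
  linarith


/-! ## §4 The route reading: the CageBudgetFekete child from the route's other items -/

/-- **`CageBudgetFekete.ConductanceLowerBound` from the route's OTHER items.**  On route CageBudgetFekete the child stmt-11749 of the
gen-1 split of `AbelThermodynamicLimit` is implied by `SymmetricSetup`, `HeatVarianceCalculus`, `QuasiSuperadditiveHeatVariance`,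
`UnboundedHeatVariance` (the route's frame and its rank-2 / rank-4 bets) together with the sibling child `UniformAbelianRegularity`
(stmt-13416; only its lower half is used).  [cite: KunduDharNarayan2009, p. 3] -/
theorem conductanceLowerBound_of_heatVarianceBets
    (hSet : Summit.AtomisticToContinuum.FouriersLaw.Theses.CageBudgetFekete.SymmetricSetup)
    (hHC : Summit.AtomisticToContinuum.FouriersLaw.Theses.CageBudgetFekete.HeatVarianceCalculus)
    (hQ : Summit.AtomisticToContinuum.FouriersLaw.Theses.CageBudgetFekete.QuasiSuperadditiveHeatVariance)
    (hU : Summit.AtomisticToContinuum.FouriersLaw.Theses.CageBudgetFekete.UnboundedHeatVariance)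
    (hR : Summit.AtomisticToContinuum.FouriersLaw.Theses.CageBudgetFekete.UniformAbelianRegularity) :
    Summit.AtomisticToContinuum.FouriersLaw.Theses.CageBudgetFekete.ConductanceLowerBound :=
  conductanceLowerBound_of_abelFloor_and_signedSlowRegularity
    (abelFloor_openChain_of_bulkWitness (stub_bulkAbelFloor_of_heatVarianceBets hSet hHC hQ hU))
    (slowRegularity_signed_of_uniformAbelianRegularity hR)

end Summit.AtomisticToContinuum.FouriersLaw.Cruxes.ConductanceLowerBound.AbelFloorExchange

end
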